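import Literature.NumberTheory.EllipticCurves.CharIdealDualLocalizationStepProofs
import Literature.NumberTheory.EllipticCurves.IwasawaAlgebraPseudoNullProofs
import Literature.NumberTheory.EllipticCurves.IwasawaAlgebraRankOneIdealProofs
import HarnessLib

/-!
# One inflation step for characteristic ideals of Pontryagin duals over `Λ = ℤ_p⟦T⟧`:
# `0 → A → B → L` exact with `A^∨` FINITE ⟹ `B^∨` is f.g. torsion and `Ch(L^∨) ∋ P ⟹ P ∈ Ch(B^∨)`

Generic commutative algebra (THEOREMS ONLY; no definition, no named fact, no `sorry`), the algebraic
frame of the local computation at a FINITELY DECOMPOSED place in [GreenbergVatsal2000] Prop. 2.4 ∕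
[Skinner2016PacificMC] §2.3 ∕ [JetchevSkinnerWan2017] proof of Thm. 6.1.6 (cell `bsd-stepL`, K2 support
20495 `JSWSigmaLocalCharIdeal`, module L5 of the discharge plan; seat `bsd-stepL-imc-p1` g13): with
`A = H¹(D_w/I_w, M^{I_w})` (inflation, injective), `B = H¹(D_w, M)`, `L = H¹(I_w, M)` (restriction),
the inflation–restriction sequence `0 → A → B → L` is exact, `A^∨` is FINITE when the Frobenius
exponent `c = κ(φ_w)` is non-zero, and the local term `P_w` lies in `Ch_Λ(L^∨)`; this file turns those
three inputs into the three conjuncts of the local atom for `B^∨ = X_w`: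

* **`Module.moduleFinite_isTorsion_mem_charIdeal_of_exact_dual_of_finite`** — `B^∨` finitely
  generated (extension of the quotient `(B/A)^∨` of `L^∨` by the finite `A^∨`), torsion, and
  `P ∈ Ch(B^∨)` (the tree's `Module.isTorsion_and_charIdeal_mul_span_le_of_exact_dual` with
  `Ch(A^∨) = ⊤`: a finite `Λ`-module is pseudo-null, `isPseudoNull_of_finite` ∕ `charIdeal_eq_top_of_isPseudoNull`).

Also: `Module.isTorsion_of_finite_iwasawa` (a finite `Λ`-module is torsion).

References: [GreenbergVatsal2000] §2, Prop. 2.4; [Skinner2016PacificMC] §2.3 (p. 180);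
[JetchevSkinnerWan2017] proof of Thm. 6.1.6; Bourbaki AC VII §4.5 Prop. 10; [Washington1997] §13.2
(pseudo-null = finite over `Λ`).
-/

noncomputable section

open scoped Classical

namespace Literature.NumberTheory.EllipticCurves.Module

open CharacterModule

variable {p : ℕ} [Fact p.Prime]
variable {A B L : Type*} [AddCommGroup A] [_root_.Module (IwasawaAlgebra p) A]
  [AddCommGroup B] [_root_.Module (IwasawaAlgebra p) B]
  [AddCommGroup L] [_root_.Module (IwasawaAlgebra p) L]

/-- **A finite `Λ`-module is torsion** (`Λ = ℤ_p⟦T⟧` is an infinite domain: for `x ∈ N` the orbit map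
`r ↦ r • x` from the infinite `Λ` to the finite `N` is not injective, so some non-zero `r` kills `x`).
[cite: Washington1997, §13.2 (finite Λ-modules are pseudo-null)] -/
theorem isTorsion_of_finite_iwasawa (N : Type*) [AddCommGroup N] [_root_.Module (IwasawaAlgebra p) N]
    [Finite N] : Module.IsTorsion (IwasawaAlgebra p) N := by
  intro x
  haveI : Infinite ℤ_[p] := Infinite.of_injective (fun n : ℕ => (n : ℤ_[p])) Nat.cast_injective
  haveI : Infinite (IwasawaAlgebra p) :=
    Infinite.of_injective (⇑(PowerSeries.C : ℤ_[p] →+* IwasawaAlgebra p)) PowerSeries.C_injective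
  have hni : ¬ Function.Injective fun r : IwasawaAlgebra p => r • x := not_injective_infinite_finite _
  obtain ⟨r, s, hrs, hne⟩ := Function.not_injective_iff.mp hni
  refine ⟨⟨r - s, mem_nonZeroDivisors_of_ne_zero (sub_ne_zero.mpr hne)⟩, ?_⟩
  change (r - s) • x = 0
  rw [sub_smul, sub_eq_zero]
  exact hrs

/-- **One inflation step** (Greenberg–Vatsal Prop. 2.4 frame). Over `Λ = ℤ_p⟦T⟧`, let `i : A ↪ B` be
injective and `r : B → L` with `0 → A → B → L` exact at `B` (e.g. inflation–restriction), with `A^∨`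
FINITE and `L^∨` finitely generated torsion with `P ∈ Ch_Λ(L^∨)` (all duals Mathlib `CharacterModule`s,
`Ch` the tree's `Module.charIdeal`). Then `B^∨` is finitely generated and torsion, and `P ∈ Ch_Λ(B^∨)`:
`B^∨` is an extension of the finite `A^∨` by `(B/i(A))^∨`, a quotient of `L^∨`; then
`Ch(A^∨)·(P) ⊆ Ch(B^∨)` (`isTorsion_and_charIdeal_mul_span_le_of_exact_dual`) with `Ch(A^∨) = ⊤`
(finite ⟹ pseudo-null). [cite: GreenbergVatsal2000, Prop. 2.4 (and the exact sequences of §2)]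
[cite: Skinner2016PacificMC, §2.3 (p. 180)] [cite: Washington1997, §13.2] -/
theorem moduleFinite_isTorsion_mem_charIdeal_of_exact_dual_of_finite
    (i : A →ₗ[IwasawaAlgebra p] B) (hi : Function.Injective i) (r : B →ₗ[IwasawaAlgebra p] L)
    (hir : Function.Exact i r) [Finite (CharacterModule A)]
    [Module.Finite (IwasawaAlgebra p) (CharacterModule L)]
    (hL : Module.IsTorsion (IwasawaAlgebra p) (CharacterModule L))
    {P : IwasawaAlgebra p} (hP : P ∈ charIdeal (IwasawaAlgebra p) (CharacterModule L)) :
    Module.Finite (IwasawaAlgebra p) (CharacterModule B) ∧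
      Module.IsTorsion (IwasawaAlgebra p) (CharacterModule B) ∧
      P ∈ charIdeal (IwasawaAlgebra p) (CharacterModule B) := by
  -- the quotient `Q = B / i(A)` embeds into `L`
  set U : Submodule (IwasawaAlgebra p) B := LinearMap.range i with hU
  have hle : U ≤ LinearMap.ker r := by rw [hU, ← hir.linearMap_ker_eq]
  set rbar : (B ⧸ U) →ₗ[IwasawaAlgebra p] L := U.liftQ r hle with hrbar_def
  have hrbar : Function.Injective rbar := by
    rw [← LinearMap.ker_eq_bot]
    exact Submodule.ker_liftQ_eq_bot _ _ _ (by rw [hU, ← hir.linearMap_ker_eq])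
  have hψ : Function.Surjective (dual rbar) := dual_surjective_of_injective rbar hrbar
  haveI : Module.Finite (IwasawaAlgebra p) (CharacterModule (B ⧸ U)) :=
    Module.Finite.of_surjective (dual rbar) hψ
  -- `0 → Q^∨ → B^∨ → A^∨ → 0`
  have hg₁ : Function.Surjective (dual i) := dual_surjective_of_injective i hi
  have hex₁ : Function.Exact (dual (R := IwasawaAlgebra p) U.mkQ) (dual i) :=
    TateBourbaki.exact_dual_mkQ_dual i
  -- `B^∨` is finitely generated: extension of f.g. by f.g.
  haveI : Module.Finite (IwasawaAlgebra p) (CharacterModule A) := Module.Finite.of_finite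
  have hfgB : Module.Finite (IwasawaAlgebra p) (CharacterModule B) := by
    rw [Module.finite_def]
    refine Submodule.fg_of_fg_map_of_fg_inf_ker (dual i) ?_ ?_
    · rw [Submodule.map_top, LinearMap.range_eq_top.mpr hg₁]
      exact Module.finite_def.mp inferInstance
    · rw [top_inf_eq, hex₁.linearMap_ker_eq, LinearMap.range_eq_map]
      exact (Module.finite_def.mp inferInstance).map _
  haveI := hfgB
  -- torsion and `Ch(A^∨)·(P) ≤ Ch(B^∨)` (one localisation step), with `Ch(A^∨) = ⊤`
  have hA : Module.IsTorsion (IwasawaAlgebra p) (CharacterModule A) :=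
    isTorsion_of_finite_iwasawa (CharacterModule A)
  obtain ⟨hB, hCh⟩ := isTorsion_and_charIdeal_mul_span_le_of_exact_dual i hi r hir hA hL hP
  have htop : charIdeal (IwasawaAlgebra p) (CharacterModule A) = ⊤ :=
    charIdeal_eq_top_of_isPseudoNull (isPseudoNull_of_finite p (CharacterModule A))
  rw [htop, Ideal.top_mul] at hCh
  exact ⟨hfgB, hB, hCh (Ideal.mem_span_singleton_self P)⟩

end Literature.NumberTheory.EllipticCurves.Module

end
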